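import Summits.ResolutionOfSingularities.ResolutionOfSingularities.Theorems.PurelyInseparableDim4SwapTransportRotation
import Summits.ResolutionOfSingularities.ResolutionOfSingularities.Theorems.PurelyInseparableDim4ShadeTwoSwapRead
import HarnessLib
import HarnessLib.Audit.Tags

/-!
# Purely inseparable four-folds — READINGS through a two-letter slot-unit-class frame: the tangent map is invertible,
# so isolation and `ord₀` pass from the real state to the virtual one (cell `res-dim4-pi`, K2(p) lane, slice B;
# K24b-R1 «rotation residual of the C∞ assembly», file `read_of_rel₂`)

[OURS · counted 0 · cell `res-dim4-pi` · K2(p) lane holder's ruling 2026-08-29 04:33:16Z (K24b-R1 (b), res-dim4-typ-1 g3);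
the one-letter pattern is res-dim4-p-7 g3's SN4a `SwapNorm.isUnit_det_unitClass` / `read_of_rel` over res-dim4-p-11 g3's J1
`JetInverse.exists_approx_inverse` and SN2 `isIsolated_of_rel` / `ordZero_of_rel`.]  Nothing here proves K2(p)/K2(5),
`NoIsolatedTrap 5 5` or resolution of singularities in dimension ≥ 4 / characteristic `p` — NOT proved.  AI kernel work,
weaker than expert review.

* §1 `slotUnitClass_origin₂` — a slot-unit-class substitution fixes the origin; **`isUnit_det_slotUnitClass₂`** — its tangent
  matrix is, after the row permutation `π` and the reindexing (slots | free letters), BLOCK LOWER-TRIANGULAR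
  `[[diag(e_a(0), e_{a′}(0)), 0], [∗, F]]`, so `det = ± e_a(0)·e_{a′}(0)·det F` — a unit iff the free `2 × 2` block `F` of linear
  coefficients is invertible (the datum `unitFrame_step₂` / `unitFrame_rotate₂` carry explicitly: `det F ↦ w²·det F`, resp.
  `↦ −e_a(0)/λ³ · det F`).
* §2 **`read_of_rel₂`** — J1 + SN2: a virtual state `B` related to an isolated real state `A` by a slot-unit-class frame at a
  level `M` past `A`'s isolation certificate is ISOLATED with the same `ord₀` (`p ∤ ord₀`, `ord₀ < M`).
* §3 `exists_virtual_translation_step` / `exists_virtual_translation_rotate` — Cramer on the free block: the virtual translation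
  (and the scalar `λ`) satisfying the 1-jet relations of `unitFrame_step₂` / `unitFrame_rotate₂` exist.
* §4 `det_after_step` (`det F ↦ w²·det F`), `det_after_rotate` (`λ³·det F′ = −e_a(0)·det F`) — the invertibility of the free
  block is carried along the window.
bears_on: LADDER-RESOLUTION:D157-DOOR2 (res-dim4-pi · K2(p) · slice B · K24b-R1).  Supports
stmt-ResolutionOfSingularities-16155 (helper).
-/

set_option linter.dupNamespace false -- mandated namespace of this single-conjunct summit

noncomputable section

namespace Summit.ResolutionOfSingularities.ResolutionOfSingularities.Theorems.PIDim4

namespace SwapTransport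

open MvPolynomial Finset
open Literature.AlgebraicGeometry.Resolution
open Literature.AlgebraicGeometry.Resolution.CentreBlowup
open Literature.AlgebraicGeometry.Resolution.Hauser2010

variable {K : Type} [Field K]

/-! ## §1 The tangent map of a slot-unit-class substitution -/

/-- A slot-unit-class substitution fixes the origin. [folklore] -/
theorem slotUnitClass_origin₂ {π : Equiv.Perm (Fin 4)} {a a' u f : Fin 4} (haa' : a ≠ a') (hau : a ≠ u) (haf : a ≠ f)
    (ha'u : a' ≠ u) (ha'f : a' ≠ f) (huf : u ≠ f) {θ e : Fin 4 → MvPolynomial (Fin 4) K}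
    (hθa : θ (π a) = X a * e a) (hθa' : θ (π a') = X a' * e a') (hu0 : constantCoeff (θ (π u)) = 0)
    (hf0 : constantCoeff (θ (π f)) = 0) : ∀ k, constantCoeff (θ k) = 0 := by
  intro k
  obtain ⟨i, rfl⟩ := π.surjective k
  rcases letters4 haa' hau haf ha'u ha'f huf i with h | h | h | h <;> rw [h]
  · rw [hθa, map_mul, constantCoeff_X, zero_mul]
  · rw [hθa', map_mul, constantCoeff_X, zero_mul]
  · exact hu0
  · exact hf0

/-- The reindexing `(slots | free letters) : Fin 2 ⊕ Fin 2 ≃ Fin 4` for four distinct letters. [folklore] -/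
theorem blockIndex_bijective {a a' u f : Fin 4} (haa' : a ≠ a') (hau : a ≠ u) (haf : a ≠ f) (ha'u : a' ≠ u) (ha'f : a' ≠ f)
    (huf : u ≠ f) : Function.Bijective (Sum.elim ![a, a'] ![u, f] : Fin 2 ⊕ Fin 2 → Fin 4) := by
  rw [Fintype.bijective_iff_injective_and_card]
  refine ⟨?_, by simp⟩
  rintro (i | i) (j | j) h <;> fin_cases i <;> fin_cases j <;>
    simp_all [haa'.symm, hau.symm, haf.symm, ha'u.symm, ha'f.symm, huf.symm]

/-- **THE TANGENT MAP OF A SLOT-UNIT-CLASS SUBSTITUTION IS INVERTIBLE iff its free block is**: with slots `a, a′` (images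
`x_a e_a`, `x_{a′} e_{a′}`, units) and free letters `u, f`, `det (∂θ_i/∂x_k(0))` is a unit as soon as the `2 × 2` block of the
linear coefficients of `θ(x_{π u}), θ(x_{π f})` at `x_u, x_f` is invertible. [folklore] -/
theorem isUnit_det_slotUnitClass₂ {π : Equiv.Perm (Fin 4)} {a a' u f : Fin 4} (haa' : a ≠ a') (hau : a ≠ u) (haf : a ≠ f)
    (ha'u : a' ≠ u) (ha'f : a' ≠ f) (huf : u ≠ f) {θ e : Fin 4 → MvPolynomial (Fin 4) K}
    (hθa : θ (π a) = X a * e a) (hθa' : θ (π a') = X a' * e a') (hea : constantCoeff (e a) ≠ 0)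
    (hea' : constantCoeff (e a') ≠ 0)
    (hdet : coeff (Finsupp.single u 1) (θ (π u)) * coeff (Finsupp.single f 1) (θ (π f)) -
      coeff (Finsupp.single f 1) (θ (π u)) * coeff (Finsupp.single u 1) (θ (π f)) ≠ 0) :
    IsUnit (Matrix.det (Matrix.of fun i k => coeff (Finsupp.single k 1) (θ i))) := by
  classical
  set L : Matrix (Fin 4) (Fin 4) K := Matrix.of fun i k => coeff (Finsupp.single k 1) (θ i) with hL
  -- rows re-indexed by `π`
  set T : Matrix (Fin 4) (Fin 4) K := L.submatrix π id with hT
  have hTik : ∀ i k, T i k = coeff (Finsupp.single k 1) (θ (π i)) := fun i k => rfl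
  -- the block reindexing `(a, a′ | u, f)`
  set σ : Fin 2 ⊕ Fin 2 ≃ Fin 4 := Equiv.ofBijective _ (blockIndex_bijective haa' hau haf ha'u ha'f huf) with hσ
  have hσl0 : σ (Sum.inl 0) = a := rfl
  have hσl1 : σ (Sum.inl 1) = a' := rfl
  have hσr0 : σ (Sum.inr 0) = u := rfl
  have hσr1 : σ (Sum.inr 1) = f := rfl
  set A : Matrix (Fin 2) (Fin 2) K := Matrix.of fun i j => T (σ (Sum.inl i)) (σ (Sum.inl j)) with hA
  set C : Matrix (Fin 2) (Fin 2) K := Matrix.of fun i j => T (σ (Sum.inr i)) (σ (Sum.inl j)) with hC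
  set D : Matrix (Fin 2) (Fin 2) K := Matrix.of fun i j => T (σ (Sum.inr i)) (σ (Sum.inr j)) with hD
  -- slot rows have no free entries: the upper-right block vanishes
  have hslot : ∀ (s : Fin 4) (es : MvPolynomial (Fin 4) K) (k : Fin 4), θ (π s) = X s * es → k ≠ s →
      coeff (Finsupp.single k 1) (θ (π s)) = 0 := by
    intro s es k hs hks
    rw [hs, SwapNorm.coeff_single_X_mul_eq, if_neg hks]
  have hblocks : T.submatrix σ σ = Matrix.fromBlocks A 0 C D := by
    ext (i | i) (j | j)
    · rfl
    · rw [Matrix.submatrix_apply, Matrix.fromBlocks_apply₁₂, Matrix.zero_apply, hTik]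
      fin_cases i <;> fin_cases j
      · exact hslot a (e a) u hθa hau.symm
      · exact hslot a (e a) f hθa haf.symm
      · exact hslot a' (e a') u hθa' ha'u.symm
      · exact hslot a' (e a') f hθa' ha'f.symm
    · rfl
    · rfl
  have hdetA : A.det = constantCoeff (e a) * constantCoeff (e a') := by
    rw [Matrix.det_fin_two]
    simp only [hA, Matrix.of_apply, hTik, hσl0, hσl1]
    rw [hθa, hθa', SwapNorm.coeff_single_X_mul_eq, SwapNorm.coeff_single_X_mul_eq, SwapNorm.coeff_single_X_mul_eq,
      SwapNorm.coeff_single_X_mul_eq, if_pos rfl, if_pos rfl, if_neg haa', if_neg haa'.symm]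
    ring
  have hdetD : D.det = coeff (Finsupp.single u 1) (θ (π u)) * coeff (Finsupp.single f 1) (θ (π f)) -
      coeff (Finsupp.single f 1) (θ (π u)) * coeff (Finsupp.single u 1) (θ (π f)) := by
    rw [Matrix.det_fin_two]
    simp only [hD, Matrix.of_apply, hTik, hσr0, hσr1]
  have hdetT : T.det = constantCoeff (e a) * constantCoeff (e a') *
      (coeff (Finsupp.single u 1) (θ (π u)) * coeff (Finsupp.single f 1) (θ (π f)) -
        coeff (Finsupp.single f 1) (θ (π u)) * coeff (Finsupp.single u 1) (θ (π f))) := by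
    rw [← Matrix.det_submatrix_equiv_self σ T, hblocks, Matrix.det_fromBlocks_zero₁₂, hdetA, hdetD]
  -- back to `L` through the row permutation
  have hLdet : L.det = Equiv.Perm.sign π * T.det := by
    have h := Matrix.det_permute π L
    have hs : ((Equiv.Perm.sign π : ℤ) : K) * ((Equiv.Perm.sign π : ℤ) : K) = 1 := by
      rw [← Int.cast_mul, ← Units.val_mul, Int.units_mul_self, Units.val_one, Int.cast_one]
    calc L.det = ((Equiv.Perm.sign π : ℤ) : K) * (((Equiv.Perm.sign π : ℤ) : K) * L.det) := by
          rw [← mul_assoc, hs, one_mul]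
      _ = _ := by rw [← h]
  rw [hLdet, hdetT]
  refine isUnit_iff_ne_zero.mpr (mul_ne_zero ?_ (mul_ne_zero (mul_ne_zero hea hea') hdet))
  rcases Int.units_eq_one_or (Equiv.Perm.sign π) with h | h <;> rw [h] <;> simp

/-! ## §2 Readings of a re-presented state -/

section Read

variable (p : ℕ) [hp : Fact p.Prime] [CharP K p]

/-- **ISOLATION AND `ord₀` PASS THROUGH A SLOT-UNIT-CLASS FRAME** (`read_of_rel₂`): if `FB = clean(Uᵖ·θ(FA)) + E`, `E ∈ 𝔪₀ᴹ`,
`θ` of slot-unit class along `π` (slots `a, a′`, free `u, f`) with invertible free block, and `FA` is isolated with certificate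
level `N` (`N + p + 1 ≤ M`) and `ord₀ FA = o`, `p ∤ o`, `o < M`, then `FB` is isolated and `ord₀ FB = o`. [OURS]
[cite: Hauser2010, §§F–G] -/
theorem read_of_rel₂ {π : Equiv.Perm (Fin 4)} {a a' u f : Fin 4} (haa' : a ≠ a') (hau : a ≠ u) (haf : a ≠ f)
    (ha'u : a' ≠ u) (ha'f : a' ≠ f) (huf : u ≠ f) {M N o : ℕ} {FA FB : MvPolynomial (Fin 4) K}
    {θ e : Fin 4 → MvPolynomial (Fin 4) K} {U E : MvPolynomial (Fin 4) K}
    (hθa : θ (π a) = X a * e a) (hθa' : θ (π a') = X a' * e a') (hea : constantCoeff (e a) ≠ 0)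
    (hea' : constantCoeff (e a') ≠ 0) (hu0 : constantCoeff (θ (π u)) = 0) (hf0 : constantCoeff (θ (π f)) = 0)
    (hdet : coeff (Finsupp.single u 1) (θ (π u)) * coeff (Finsupp.single f 1) (θ (π f)) -
      coeff (Finsupp.single f 1) (θ (π u)) * coeff (Finsupp.single u 1) (θ (π f)) ≠ 0)
    (hU : constantCoeff U ≠ 0) (hE : E ∈ originIdeal K ^ M) (hrel : FB = deletePthPowers p (U ^ p * aeval θ FA) + E)
    (hiso : IsIsolated p FA) (hN : originIdeal K ^ N ≤ singLocusIdeal p FA ⊔ originIdeal K ^ (N + 1))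
    (hM : N + p + 1 ≤ M) (ho : ordZero FA = o) (hpo : ¬ p ∣ o) (hoM : o < M) :
    IsIsolated p FB ∧ ordZero FB = o := by
  have hθ0 := slotUnitClass_origin₂ haa' hau haf ha'u ha'f huf hθa hθa' hu0 hf0
  obtain ⟨θ', hθ'0, hθθ', hθ'θ⟩ := JetInverse.exists_approx_inverse θ hθ0
    (isUnit_det_slotUnitClass₂ haa' hau haf ha'u ha'f huf hθa hθa' hea hea' hdet) M
  exact ⟨SwapNorm.isIsolated_of_rel p hθ0 hθ'0 hθθ' hθ'θ hU hE hrel hiso.1 hN hM,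
    SwapNorm.ordZero_of_rel p hθ0 hθ'0 hθ'θ hU hE hrel ho hpo hoM⟩

end Read


/-! ## §3 Solving the 1-jet relations (the virtual translation of a step) -/

/-- Cramer for the free `2 × 2` block: the linear system `c_uu·x + c_uf·y = r_u`, `c_fu·x + c_ff·y = r_f` is solvable when
`c_uu·c_ff − c_uf·c_fu ≠ 0`. [folklore] -/
theorem exists_solve_two {cuu cuf cfu cff ru rf : K} (hdet : cuu * cff - cuf * cfu ≠ 0) :
    ∃ x y : K, cuu * x + cuf * y = ru ∧ cfu * x + cff * y = rf := by
  refine ⟨(ru * cff - cuf * rf) / (cuu * cff - cuf * cfu), (cuu * rf - cfu * ru) / (cuu * cff - cuf * cfu), ?_, ?_⟩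
  · rw [mul_div_assoc', mul_div_assoc', ← add_div, div_eq_iff hdet]
    ring
  · rw [mul_div_assoc', mul_div_assoc', ← add_div, div_eq_iff hdet]
    ring

/-- **The virtual translation of a SLOT step**: given the real translation `b` (supported on the two free letters) and an
invertible free block, a virtual translation `b′` supported on `{u, f}` satisfying the two 1-jet relations of
`unitFrame_step₂` exists. [OURS] -/
theorem exists_virtual_translation_step {π : Equiv.Perm (Fin 4)} {u f : Fin 4} (ℓ : Fin 4) (huf : u ≠ f)
    {θ e : Fin 4 → MvPolynomial (Fin 4) K} (b : Fin 4 → K)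
    (hdet : coeff (Finsupp.single u 1) (θ (π u)) * coeff (Finsupp.single f 1) (θ (π f)) -
      coeff (Finsupp.single f 1) (θ (π u)) * coeff (Finsupp.single u 1) (θ (π f)) ≠ 0) :
    ∃ b' : Fin 4 → K, (∀ i, i ≠ u → i ≠ f → b' i = 0) ∧
      b (π u) * constantCoeff (e ℓ) = coeff (Finsupp.single ℓ 1) (θ (π u)) +
        coeff (Finsupp.single u 1) (θ (π u)) * b' u + coeff (Finsupp.single f 1) (θ (π u)) * b' f ∧
      b (π f) * constantCoeff (e ℓ) = coeff (Finsupp.single ℓ 1) (θ (π f)) +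
        coeff (Finsupp.single u 1) (θ (π f)) * b' u + coeff (Finsupp.single f 1) (θ (π f)) * b' f := by
  obtain ⟨x, y, hx, hy⟩ := exists_solve_two (cuu := coeff (Finsupp.single u 1) (θ (π u)))
    (cuf := coeff (Finsupp.single f 1) (θ (π u))) (cfu := coeff (Finsupp.single u 1) (θ (π f)))
    (cff := coeff (Finsupp.single f 1) (θ (π f)))
    (ru := b (π u) * constantCoeff (e ℓ) - coeff (Finsupp.single ℓ 1) (θ (π u)))
    (rf := b (π f) * constantCoeff (e ℓ) - coeff (Finsupp.single ℓ 1) (θ (π f)))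
    (fun h => hdet (by linear_combination h))
  obtain ⟨b', hb'⟩ : ∃ b' : Fin 4 → K, b' = fun i => if i = u then x else if i = f then y else 0 := ⟨_, rfl⟩
  have hbu : b' u = x := by rw [hb']; dsimp only; rw [if_pos rfl]
  have hbf : b' f = y := by rw [hb']; dsimp only; rw [if_neg huf.symm, if_pos rfl]
  refine ⟨b', fun i hiu hif => ?_, ?_, ?_⟩
  · rw [hb']; dsimp only; rw [if_neg hiu, if_neg hif]
  · rw [hbu, hbf]
    linear_combination -hx
  · rw [hbu, hbf]
    linear_combination -hy

/-- **The virtual translation of a ROTATION step**: the real chain steps in the chart of the free letter `π g` and drops the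
slot `π a` (`b (π a) ≠ 0`); with an invertible free block, the scalar `λ := e_a(0)/b(π a)` and a virtual translation `b′`
supported on `{g, g̃}` satisfying the three relations of `unitFrame_rotate₂` exist. [OURS] -/
theorem exists_virtual_translation_rotate {π : Equiv.Perm (Fin 4)} {a a' g gt : Fin 4} (hag : a ≠ g)
    (hagt : a ≠ gt) (ha'g : a' ≠ g) (ha'gt : a' ≠ gt) (hggt : g ≠ gt) {θ e : Fin 4 → MvPolynomial (Fin 4) K}
    (b : Fin 4 → K) (hba : b (π a) ≠ 0)
    (hdet : coeff (Finsupp.single g 1) (θ (π g)) * coeff (Finsupp.single gt 1) (θ (π gt)) -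
      coeff (Finsupp.single gt 1) (θ (π g)) * coeff (Finsupp.single g 1) (θ (π gt)) ≠ 0) :
    ∃ (lam : K) (b' : Fin 4 → K), b' a = 0 ∧ b' a' = 0 ∧ lam * b (π a) = constantCoeff (e a) ∧
      coeff (Finsupp.single a 1) (θ (π g)) + coeff (Finsupp.single g 1) (θ (π g)) * b' g +
        coeff (Finsupp.single gt 1) (θ (π g)) * b' gt = lam ∧
      coeff (Finsupp.single a 1) (θ (π gt)) + coeff (Finsupp.single g 1) (θ (π gt)) * b' g +
        coeff (Finsupp.single gt 1) (θ (π gt)) * b' gt = lam * b (π gt) := by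
  obtain ⟨lam, hlam⟩ : ∃ lam : K, lam = constantCoeff (e a) / b (π a) := ⟨_, rfl⟩
  obtain ⟨x, y, hx, hy⟩ := exists_solve_two (cuu := coeff (Finsupp.single g 1) (θ (π g)))
    (cuf := coeff (Finsupp.single gt 1) (θ (π g))) (cfu := coeff (Finsupp.single g 1) (θ (π gt)))
    (cff := coeff (Finsupp.single gt 1) (θ (π gt))) (ru := lam - coeff (Finsupp.single a 1) (θ (π g)))
    (rf := lam * b (π gt) - coeff (Finsupp.single a 1) (θ (π gt))) (fun h => hdet (by linear_combination h))
  obtain ⟨b', hb'⟩ : ∃ b' : Fin 4 → K, b' = fun i => if i = g then x else if i = gt then y else 0 := ⟨_, rfl⟩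
  have hbg : b' g = x := by rw [hb']; dsimp only; rw [if_pos rfl]
  have hbgt : b' gt = y := by rw [hb']; dsimp only; rw [if_neg hggt.symm, if_pos rfl]
  refine ⟨lam, b', ?_, ?_, by rw [hlam, div_mul_cancel₀ _ hba], ?_, ?_⟩
  · rw [hb']; dsimp only; rw [if_neg hag, if_neg hagt]
  · rw [hb']; dsimp only; rw [if_neg ha'g, if_neg ha'gt]
  · rw [hbg, hbgt]
    linear_combination hx
  · rw [hbg, hbgt]
    linear_combination hy

/-! ## §4 Determinant bookkeeping along the window -/

/-- After a SLOT step (`unitFrame_step₂`'s tangent rows: the free rows are scaled by `w` off the chart letter), the free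
block's determinant is multiplied by `w²`. [OURS · bookkeeping] -/
theorem det_after_step {π : Equiv.Perm (Fin 4)} {u f ℓ : Fin 4} (hℓu : ℓ ≠ u) (hℓf : ℓ ≠ f)
    {θ θ' : Fin 4 → MvPolynomial (Fin 4) K} {w : K}
    (hu : ∀ k, k ≠ ℓ → coeff (Finsupp.single k 1) (θ' (π u)) = w * coeff (Finsupp.single k 1) (θ (π u)))
    (hf : ∀ k, k ≠ ℓ → coeff (Finsupp.single k 1) (θ' (π f)) = w * coeff (Finsupp.single k 1) (θ (π f))) :
    coeff (Finsupp.single u 1) (θ' (π u)) * coeff (Finsupp.single f 1) (θ' (π f)) -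
        coeff (Finsupp.single f 1) (θ' (π u)) * coeff (Finsupp.single u 1) (θ' (π f)) =
      w ^ 2 * (coeff (Finsupp.single u 1) (θ (π u)) * coeff (Finsupp.single f 1) (θ (π f)) -
        coeff (Finsupp.single f 1) (θ (π u)) * coeff (Finsupp.single u 1) (θ (π f))) := by
  rw [hu u hℓu.symm, hu f hℓf.symm, hf u hℓu.symm, hf f hℓf.symm]
  ring

/-- After a ROTATION step (`unitFrame_rotate₂`'s tangent rows), with the new bijection `π′ = π ∘ (a g)` (so `π′ g = π a`,
`π′ g̃ = π g̃`), the free block's determinant is multiplied by `−e_a(0)/λ³`. [OURS · bookkeeping] -/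
theorem det_after_rotate {π : Equiv.Perm (Fin 4)} {a g gt : Fin 4} (hag : a ≠ g) (hagt : a ≠ gt)
    {θ θ' : Fin 4 → MvPolynomial (Fin 4) K} {lam ea σ : K} (hlam : lam ≠ 0)
    (hga : ∀ k, k ≠ a → lam ^ 2 * coeff (Finsupp.single k 1) (θ' (π a)) =
      -(ea * coeff (Finsupp.single k 1) (θ (π g))))
    (hgt : ∀ k, k ≠ a → lam * coeff (Finsupp.single k 1) (θ' (π gt)) =
      coeff (Finsupp.single k 1) (θ (π gt)) - σ * coeff (Finsupp.single k 1) (θ (π g))) :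
    lam ^ 3 * (coeff (Finsupp.single g 1) (θ' (π a)) * coeff (Finsupp.single gt 1) (θ' (π gt)) -
        coeff (Finsupp.single gt 1) (θ' (π a)) * coeff (Finsupp.single g 1) (θ' (π gt))) =
      -(ea * (coeff (Finsupp.single g 1) (θ (π g)) * coeff (Finsupp.single gt 1) (θ (π gt)) -
        coeff (Finsupp.single gt 1) (θ (π g)) * coeff (Finsupp.single g 1) (θ (π gt)))) := by
  have h1 := hga g hag.symm
  have h2 := hga gt hagt.symm
  have h3 := hgt g hag.symm
  have h4 := hgt gt hagt.symm
  have _ := hlam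
  linear_combination (lam * coeff (Finsupp.single gt 1) (θ' (π gt))) * h1 -
    (lam * coeff (Finsupp.single g 1) (θ' (π gt))) * h2 +
    (-(ea * coeff (Finsupp.single g 1) (θ (π g)))) * h4 - (-(ea * coeff (Finsupp.single gt 1) (θ (π g)))) * h3

end SwapTransport

end Summit.ResolutionOfSingularities.ResolutionOfSingularities.Theorems.PIDim4

end
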